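import Summits.Ventures.PercRepro.LemmaBPlusMask

/-!
# Sub-mask enumeration: the face loops in `4^k` instead of `8^k` iterations

`facesCheck` quantifies over all pairs of codes `(u, v)` and, for each, sums over all `2^k` codes
`n` with a bit-containment test — `8^k` iterations; `7` edges (`2 097 152`) no longer fit one kernel
declaration.  Here the sub-masks of a mask are LISTED (`subs D k`, by recursion on the bit index:
bit `i` is left closed, or opened on top of every sub-mask below `i` when `D` has it), with the
characterisation `mem_subs` and `subs_nodup`, so that a sum over sub-masks is a list sum
(`sum_subs`).  A face `[v, u]` is then the list of `v ||| d` for `d` a sub-mask of `u ^^^ v`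
(`faceScoreS`, `sum_interval_eq_sum_subs`), the joins `u` and meets `v ⊆ u` are enumerated the
same way, and the whole check costs `Σ_u 3^{|u|} = 4^k` iterations (`facesCheckS`,
`facesCheckS_eq`).  `FacesSRange` slices the joins for the kernel budget.
-/

namespace PercRepro

namespace MultiGraph

/-! ### Bit containment as an implication on bits -/

/-- `x &&& y = x` says every bit of `x` is a bit of `y`. -/
theorem and_eq_self_iff (x y : ℕ) : x &&& y = x ↔ ∀ i, x.testBit i = true → y.testBit i = true := by
  constructor
  · intro h i hx
    have := congrArg (fun z => z.testBit i) h
    simp only [Nat.testBit_and, hx, Bool.true_and] at this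
    exact this
  · intro h
    apply Nat.eq_of_testBit_eq
    intro i
    rw [Nat.testBit_and]
    cases hx : x.testBit i
    · rfl
    · rw [h i hx]; rfl

/-! ### The sub-masks of a mask, listed -/

/-- The sub-masks of `D` with bits below `i`. -/
def subs (D : ℕ) : ℕ → List ℕ
  | 0 => [0]
  | i + 1 => if D.testBit i then subs D i ++ (subs D i).map (· + 2 ^ i) else subs D i

/-- A number below `2 ^ (i + 1)` with bit `i` clear is below `2 ^ i`. -/
theorem lt_two_pow_of_testBit_false {x i : ℕ} (hx : x < 2 ^ (i + 1)) (hb : x.testBit i = false) :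
    x < 2 ^ i := by
  apply Nat.lt_pow_two_of_testBit
  intro j hj
  rcases Nat.eq_or_lt_of_le hj with rfl | hlt
  · exact hb
  · exact Nat.testBit_lt_two_pow (lt_of_lt_of_le hx (Nat.pow_le_pow_right (by norm_num) hlt))

/-- **The members of `subs D i` are exactly the sub-masks of `D` below `2 ^ i`.** -/
theorem mem_subs (D : ℕ) : ∀ (i x : ℕ), x ∈ subs D i ↔ x < 2 ^ i ∧ x &&& D = x := by
  intro i
  induction i with
  | zero =>
    intro x
    simp only [subs, List.mem_singleton, pow_zero, Nat.lt_one_iff]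
    constructor
    · rintro rfl; exact ⟨rfl, Nat.zero_and D⟩
    · exact fun h => h.1
  | succ i ih =>
    intro x
    rw [subs]
    split_ifs with hD
    · rw [List.mem_append, List.mem_map, ih]
      constructor
      · rintro (⟨hx, hs⟩ | ⟨y, hy, rfl⟩)
        · exact ⟨lt_of_lt_of_le hx (Nat.pow_le_pow_right (by norm_num) (Nat.le_succ i)), hs⟩
        · obtain ⟨hy, hys⟩ := (ih y).mp hy
          refine ⟨?_, ?_⟩
          · rw [pow_succ]; omega
          · rw [and_eq_self_iff] at hys ⊢
            intro j hj
            rw [Nat.add_comm] at hj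
            rcases lt_trichotomy j i with hji | rfl | hij
            · rw [Nat.testBit_two_pow_add_gt hji] at hj
              exact hys j hj
            · exact hD
            · exfalso
              have : 2 ^ i + y < 2 ^ j := by
                calc 2 ^ i + y < 2 ^ i + 2 ^ i := by omega
                  _ = 2 ^ (i + 1) := by ring
                  _ ≤ 2 ^ j := Nat.pow_le_pow_right (by norm_num) hij
              rw [Nat.testBit_lt_two_pow this] at hj
              exact Bool.false_ne_true hj
      · rintro ⟨hx, hs⟩
        cases hb : x.testBit i
        · exact Or.inl ⟨lt_two_pow_of_testBit_false hx hb, hs⟩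
        · right
          have hge : 2 ^ i ≤ x := Nat.ge_two_pow_of_testBit hb
          refine ⟨x - 2 ^ i, (ih _).mpr ⟨?_, ?_⟩, by omega⟩
          · have : x < 2 ^ i + 2 ^ i := by rw [← two_mul, ← pow_succ']; exact hx
            omega
          · rw [and_eq_self_iff] at hs ⊢
            intro j hj
            have hx' : x = 2 ^ i + (x - 2 ^ i) := by omega
            rcases lt_trichotomy j i with hji | rfl | hij
            · apply hs
              rw [hx', Nat.testBit_two_pow_add_gt hji]
              exact hj
            · exfalso
              have : x - 2 ^ j < 2 ^ j := by
                have : x < 2 ^ j + 2 ^ j := by rw [← two_mul, ← pow_succ']; exact hx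
                omega
              rw [Nat.testBit_lt_two_pow this] at hj
              exact Bool.false_ne_true hj
            · exfalso
              have : x - 2 ^ i < 2 ^ j := by
                have : x < 2 ^ (i + 1) := hx
                have := Nat.pow_le_pow_right (show 0 < 2 by norm_num) hij
                omega
              rw [Nat.testBit_lt_two_pow this] at hj
              exact Bool.false_ne_true hj
    · rw [ih]
      constructor
      · rintro ⟨hx, hs⟩
        exact ⟨lt_of_lt_of_le hx (Nat.pow_le_pow_right (by norm_num) (Nat.le_succ i)), hs⟩
      · rintro ⟨hx, hs⟩
        refine ⟨lt_two_pow_of_testBit_false hx ?_, hs⟩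
        cases hb : x.testBit i
        · rfl
        · exfalso
          rw [and_eq_self_iff] at hs
          exact hD (hs i hb)

/-- The listed sub-masks have no duplicates. -/
theorem subs_nodup (D : ℕ) : ∀ i, (subs D i).Nodup := by
  intro i
  induction i with
  | zero => simp [subs]
  | succ i ih =>
    rw [subs]
    split_ifs with hD
    · refine List.Nodup.append ih (ih.map fun a b h => by omega) ?_
      intro x hx hx'
      rw [mem_subs] at hx
      rw [List.mem_map] at hx'
      obtain ⟨y, _, rfl⟩ := hx'
      have := hx.1
      omega
    · exact ih

/-- **A sum over the listed sub-masks is the guarded sum over all codes.** -/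
theorem sum_subs {M : Type*} [AddCommMonoid M] (D k : ℕ) (F : ℕ → M) :
    ((subs D k).map F).sum = ∑ d : Fin (2 ^ k), if d.val &&& D = d.val then F d.val else 0 := by
  rw [← List.sum_toFinset F (subs_nodup D k)]
  have hset : (subs D k).toFinset = (Finset.range (2 ^ k)).filter fun d => d &&& D = d := by
    ext d
    rw [List.mem_toFinset, mem_subs, Finset.mem_filter, Finset.mem_range]
  rw [hset, Finset.sum_filter, Finset.sum_range]

/-! ### A face as the sub-masks of its free set -/

/-- Every bit of `x` is a bit of `y`, pointwise. -/
theorem testBit_of_and_eq_self {x y : ℕ} (h : x &&& y = x) (i : ℕ) (hx : x.testBit i = true) :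
    y.testBit i = true :=
  (and_eq_self_iff x y).mp h i hx

/-- Inside an interval `[v, u]`, the free part `n ^^^ v` is a sub-mask of `u ^^^ v`. -/
theorem xor_sub_of_mem_interval {u v n : ℕ} (hv : v &&& n = v) (hu : n &&& u = n) :
    (n ^^^ v) &&& (u ^^^ v) = n ^^^ v := by
  rw [and_eq_self_iff]
  intro i hi
  have h1 := testBit_of_and_eq_self hv i
  have h2 := testBit_of_and_eq_self hu i
  simp only [Nat.testBit_xor] at hi ⊢
  revert hi h1 h2
  cases v.testBit i <;> cases n.testBit i <;> cases u.testBit i <;> simp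

/-- A sub-mask `d` of `u ^^^ v` gives the interval point `v ||| d`. -/
theorem or_mem_interval {u v d : ℕ} (hvu : v &&& u = v) (hd : d &&& (u ^^^ v) = d) :
    v &&& (v ||| d) = v ∧ (v ||| d) &&& u = v ||| d := by
  constructor
  · rw [and_eq_self_iff]
    intro i hi
    simp [Nat.testBit_or, hi]
  · rw [and_eq_self_iff]
    intro i hi
    have h1 := testBit_of_and_eq_self hvu i
    have h2 := testBit_of_and_eq_self hd i
    simp only [Nat.testBit_or, Nat.testBit_xor] at hi h2 ⊢
    revert hi h1 h2
    cases v.testBit i <;> cases d.testBit i <;> cases u.testBit i <;> simp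

/-- Re-assembling an interval point from its free part. -/
theorem or_xor_of_le {v n : ℕ} (hv : v &&& n = v) : v ||| (n ^^^ v) = n := by
  apply Nat.eq_of_testBit_eq
  intro i
  have h1 := testBit_of_and_eq_self hv i
  simp only [Nat.testBit_or, Nat.testBit_xor]
  revert h1
  cases v.testBit i <;> cases n.testBit i <;> simp

/-- Extracting the free part of an assembled point. -/
theorem xor_or_of_sub {u v d : ℕ} (hvu : v &&& u = v) (hd : d &&& (u ^^^ v) = d) :
    (v ||| d) ^^^ v = d := by
  apply Nat.eq_of_testBit_eq
  intro i
  have h1 := testBit_of_and_eq_self hvu i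
  have h2 := testBit_of_and_eq_self hd i
  simp only [Nat.testBit_or, Nat.testBit_xor] at h2 ⊢
  revert h1 h2
  cases v.testBit i <;> cases d.testBit i <;> cases u.testBit i <;> simp

/-- **The guarded sum over an interval `[v, u]` is the list sum over the sub-masks of `u ^^^ v`.** -/
theorem sum_interval_eq_sum_subs {M : Type*} [AddCommMonoid M] (k u v : ℕ) (hu : u < 2 ^ k)
    (hvu : v &&& u = v) (F : ℕ → M) :
    (∑ n : Fin (2 ^ k), if v &&& n.val = v ∧ n.val &&& u = n.val then F n.val else 0) =
      ((subs (u ^^^ v) k).map fun d => F (v ||| d)).sum := by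
  rw [sum_subs, ← Finset.sum_filter, ← Finset.sum_filter]
  have hv : v < 2 ^ k := lt_of_le_of_lt (hvu ▸ Nat.and_le_right) hu
  refine Finset.sum_nbij' (fun n => ⟨n.val ^^^ v, Nat.xor_lt_two_pow n.isLt hv⟩)
    (fun d => ⟨v ||| d.val, Nat.or_lt_two_pow hv d.isLt⟩) ?_ ?_ ?_ ?_ ?_
  · intro n hn
    rw [Finset.mem_filter] at hn ⊢
    exact ⟨Finset.mem_univ _, xor_sub_of_mem_interval hn.2.1 hn.2.2⟩
  · intro d hd
    rw [Finset.mem_filter] at hd ⊢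
    exact ⟨Finset.mem_univ _, or_mem_interval hvu hd.2⟩
  · intro n hn
    rw [Finset.mem_filter] at hn
    exact Fin.ext (or_xor_of_le hn.2.1)
  · intro d hd
    rw [Finset.mem_filter] at hd
    exact Fin.ext (xor_or_of_sub hvu hd.2)
  · intro n hn
    rw [Finset.mem_filter] at hn
    simp only [or_xor_of_le hn.2.1]

/-! ### The face check on sub-masks -/

/-- The face score of `[v, u]` as a list sum over the sub-masks of its free set. -/
def faceScoreS (k T u v : ℕ) : ℕ :=
  ((subs (u ^^^ v) k).map fun d =>
    phiPlusEntry (rowAt T (v ||| d) * 15 + rowAt T (antipodeCode k u v (v ||| d)))).sum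

/-- The face size of `[v, u]` as a list sum. -/
def faceSizeS (k u v : ℕ) : ℕ := ((subs (u ^^^ v) k).map fun _ => 1).sum

/-- The list face score is the guarded one. -/
theorem faceScoreS_eq {k u v : ℕ} (hu : u < 2 ^ k) (hvu : v &&& u = v) (T : ℕ) :
    faceScoreS k T u v = faceScoreT k T u v := by
  unfold faceScoreS faceScoreT
  exact (sum_interval_eq_sum_subs k u v hu hvu
    (fun n => phiPlusEntry (rowAt T n * 15 + rowAt T (antipodeCode k u v n)))).symm

/-- The list face size is the guarded one. -/
theorem faceSizeS_eq {k u v : ℕ} (hu : u < 2 ^ k) (hvu : v &&& u = v) :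
    faceSizeS k u v = faceSizeM k u v := by
  unfold faceSizeS faceSizeM
  exact (sum_interval_eq_sum_subs k u v hu hvu (fun _ => 1)).symm

variable {n k : ℕ} (G : MultiGraph (Fin n) (Fin k))

/-- **The fast face check on sub-masks**: joins `u` over the codes, meets `v` over the listed
sub-masks of `u`, face points over the listed sub-masks of `u ^^^ v` — `Σ_u 3^{|u|} = 4^k`
iterations. -/
def facesCheckS (m : Fin 4 → Fin n) : Bool :=
  withLitB (G.rowTableM m) fun T =>
    decide (∀ u : Fin (2 ^ k), ∀ v ∈ subs u.val k, faceSizeS k u.val v ≤ faceScoreS k T u.val v)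

/-- The sub-mask check is the fast check. -/
theorem facesCheckS_eq (m : Fin 4 → Fin n) : G.facesCheckS m = G.facesCheckM m := by
  unfold facesCheckS facesCheckM
  congr 1
  funext T
  rw [Bool.eq_iff_iff, decide_eq_true_iff, decide_eq_true_iff]
  constructor
  · intro h u v hvu
    have := h u v.val ((mem_subs u.val k v.val).mpr ⟨v.isLt, hvu⟩)
    rwa [faceSizeS_eq u.isLt hvu, faceScoreS_eq u.isLt hvu] at this
  · intro h u v hv
    obtain ⟨hvk, hvu⟩ := (mem_subs u.val k v).mp hv
    have := h u ⟨v, hvk⟩ hvu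
    rwa [faceSizeS_eq u.isLt hvu, faceScoreS_eq u.isLt hvu]

/-- Lemma B⁺ on every face of `G` from the sub-mask check. -/
theorem facesBPlus_of_facesCheckS (m : Fin 4 → Fin n) (h : G.facesCheckS m = true) :
    G.FacesBPlus m :=
  G.facesBPlus_of_facesCheckM m (by rwa [facesCheckS_eq] at h)

/-- The sub-mask check restricted to the joins `lo ≤ u < hi` (a slice of the kernel's work). -/
def FacesSRange (m : Fin 4 → Fin n) (lo hi : ℕ) : Prop :=
  ∀ u : Fin (2 ^ k), lo ≤ u.val → u.val < hi →
    withLitB (G.rowTableM m) (fun T =>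
      decide (∀ v ∈ subs u.val k, faceSizeS k u.val v ≤ faceScoreS k T u.val v)) = true

/-- The slice is decidable. -/
instance (m : Fin 4 → Fin n) (lo hi : ℕ) : Decidable (G.FacesSRange m lo hi) := by
  unfold FacesSRange; infer_instance

/-- Two adjacent slices chain. -/
theorem facesSRange_trans (m : Fin 4 → Fin n) {lo mid hi : ℕ} (h₁ : G.FacesSRange m lo mid)
    (h₂ : G.FacesSRange m mid hi) : G.FacesSRange m lo hi := by
  intro u hlo hhi
  by_cases h : u.val < mid
  · exact h₁ u hlo h
  · exact h₂ u (not_lt.mp h) hhi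

/-- The full slice is the sub-mask check. -/
theorem facesCheckS_of_facesSRange (m : Fin 4 → Fin n) (h : G.FacesSRange m 0 (2 ^ k)) :
    G.facesCheckS m = true := by
  unfold facesCheckS
  rw [withLitB_eq, decide_eq_true_iff]
  intro u v hv
  have := h u (Nat.zero_le _) u.isLt
  rw [withLitB_eq, decide_eq_true_iff] at this
  exact this v hv


/-- The sub-mask check for ONE join `u`, restricted to the meets `vlo ≤ v < vhi` (a finer slice for
the largest joins). -/
def FacesSRangeV (m : Fin 4 → Fin n) (u vlo vhi : ℕ) : Prop :=
  withLitB (G.rowTableM m) (fun T =>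
    decide (∀ v ∈ subs u k, vlo ≤ v → v < vhi → faceSizeS k u v ≤ faceScoreS k T u v)) = true

/-- The meet slice is decidable. -/
instance (m : Fin 4 → Fin n) (u vlo vhi : ℕ) : Decidable (G.FacesSRangeV m u vlo vhi) := by
  unfold FacesSRangeV; infer_instance

/-- Two adjacent meet slices chain. -/
theorem facesSRangeV_trans (m : Fin 4 → Fin n) {u lo mid hi : ℕ} (h₁ : G.FacesSRangeV m u lo mid)
    (h₂ : G.FacesSRangeV m u mid hi) : G.FacesSRangeV m u lo hi := by
  unfold FacesSRangeV at h₁ h₂ ⊢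
  rw [withLitB_eq, decide_eq_true_iff] at h₁ h₂ ⊢
  intro v hv hlo hhi
  by_cases h : v < mid
  · exact h₁ v hv hlo h
  · exact h₂ v hv (not_lt.mp h) hhi

/-- The full meet range of one join is that join's slice. -/
theorem facesSRange_of_facesSRangeV (m : Fin 4 → Fin n) {u : ℕ}
    (h : G.FacesSRangeV m u 0 (2 ^ k)) : G.FacesSRange m u (u + 1) := by
  intro w hlo hhi
  have hw : w.val = u := by omega
  unfold FacesSRangeV at h
  rw [withLitB_eq, decide_eq_true_iff] at h
  rw [withLitB_eq, decide_eq_true_iff, hw]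
  intro v hv
  exact h v hv (Nat.zero_le _) ((mem_subs u k v).mp hv).1


end MultiGraph

end PercRepro
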